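import Literature.NumberTheory.FaltingsSerre.ParamodularTemplate
import Literature.NumberTheory.FaltingsSerre.CriterionProofs
import HarnessLib

/-!
# The Faltings–Serre method after Brumer–Pacetti–Poor–Tornaría–Voight–Yuen, VII:
# the instance theorems WITHOUT the criterion hypothesis

[BPPTVY] = A. Brumer, A. Pacetti, C. Poor, G. Tornaría, J. Voight, D. S. Yuen, *On the paramodularity of
typical abelian surfaces*, Algebra & Number Theory **13**:5 (2019) 1145–1195 [cite: BrumerEtAl2019]
(PRINTED numbering and pages).

The instance template `paramodular_of_surfaceCertificate` (file VI) and the `N = 277` instance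
`Paramodular277.paramodular_277` (file V) take the Faltings–Serre criterion [BPPTVY, Thm. 2.1.5 /
Algorithm 2.4.1 with Lemma 2.3.20 / Remark 2.4.2] as a HYPOTHESIS
`hFS : traceEq_of_faltingsSerre_symplectic` (a named fact of `Criterion.lean`).  That fact is now a
theorem, `traceEq_of_faltingsSerre_symplectic_holds` (`CriterionProofs.lean`), so the instances hold
with the hypothesis discharged: `paramodular_of_surfaceCertificate_holds`, `paramodular_277_holds`
below have EXACTLY the remaining binders — the certificate `hC` (a witness of the hypotheses of
Algorithm 2.4.1 for the pair `(ρ_{A,2}, ρ_{f,2})`), the framing of the Tate module and the good Euler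
factors of `A` (`hframe`, `hA`, [BPPTVY, (4.1.3)–(4.1.5)]), the integral form of `ρ_{f,2}` with its
Frobenius polynomials (`hρf`, [BPPTVY, Thm. 4.3.4 + Lemma 4.3.8(b) p. 1171] — the one remaining CITED and
Arthur-dependent input), the cusp form with its spinor Euler factors (`hcusp`, `hne`, `hfe`,
(4.2.18)) and the hand check at `p = 2` (`h2`).  Nothing else changes; no statement of files I–VI is
modified.

## References

* [BPPTVY] Brumer–Pacetti–Poor–Tornaría–Voight–Yuen, ANT 13:5 (2019): Thm. 1.2.1 pp. 1146–1147 (Conj. 1.1.1 p. 1146), Thm. 2.1.5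
  p. 1150, Algorithm 2.4.1 pp. 1155–1156, Thm. 4.3.4 p. 1169, Thm. 7.1.3 pp. 1187–1188.
  [cite: BrumerEtAl2019]
-/

noncomputable section

namespace Literature.NumberTheory.FaltingsSerre

open Polynomial IsDedekindDomain
open Literature.NumberTheory.GaloisRepresentations
  Literature.NumberTheory.Automorphic.Paramodular Literature.NumberTheory.Automorphic
  Literature.AlgebraicGeometry.Motives
open scoped NumberField

/-- **`A` is paramodular of level `N` away from `N`, from a surface certificate — criterion
discharged.**  Same statement as `paramodular_of_surfaceCertificate` WITHOUT the hypothesis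
`hFS : traceEq_of_faltingsSerre_symplectic`, which is supplied by the theorem
`traceEq_of_faltingsSerre_symplectic_holds` ([BPPTVY, Thm. 2.1.5 / Alg. 2.4.1], proved in
`CriterionProofs.lean`). [cite: BrumerEtAl2019, Thm 7.1.3 p. 1187; Thm 2.1.5 p. 1150; Thm 4.3.4 p. 1169] -/
theorem paramodular_of_surfaceCertificate_holds
    {N : ℕ} [NeZero N] {T : Finset ℕ}
    {A : AbelianVariety ℚ} {f : Matrix (Fin 2) (Fin 2) ℂ → ℂ}
    {ρA ρf : FramedGaloisRep ℚ ℤ_[2] 4} {J : Matrix (Fin 4) (Fin 4) ℤ_[2]}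
    {ν : Field.absoluteGaloisGroup ℚ → ℤ_[2]}
    {b : Module.Basis (Fin 4) ℚ_[2] (A.rationalTateModule 2)}
    (hC : SurfaceCertificate N T J ν ρA ρf)
    (hframe : A.IsFrameOfTateRep 2 b (rationalize ρA))
    (aA bA af bf : ℕ → ℤ)
    (hA : ∀ p : ℕ, p.Prime → ¬ p ∣ N →
      A.HasGoodEulerFactorAt p ((lPolynomialOfSurface p (aA p) (bA p)).map (Int.castRingHom ℚ)))
    (hρf : ∀ p : ℕ, p.Prime → ¬ p ∣ N → p ≠ 2 →
      ∀ v : HeightOneSpectrum (𝓞 ℚ), ((p : ℕ) : 𝓞 ℚ) ∈ v.asIdeal →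
        ρf.HasFrobCharpolyAt v
          ((lPolynomialOfSurface p (af p) (bf p)).reverse.map (Int.castRingHom ℤ_[2])))
    (hcusp : IsParamodularCuspForm N 2 f) (hne : ∃ Z ∈ siegelUpperHalfSpace 2, f Z ≠ 0)
    (hfe : ∀ p : ℕ, p.Prime → ¬ p ∣ N →
      HasSpinorEulerFactorAt 2 p f ((lPolynomialOfSurface p (af p) (bf p)).map (Int.castRingHom ℂ)))
    (h2 : ¬ 2 ∣ N → aA 2 = af 2 ∧ bA 2 = bf 2) :
    IsParamodularAwayFrom A N f :=
  paramodular_of_surfaceCertificate traceEq_of_faltingsSerre_symplectic_holds hC hframe aA bA af bf hA hρf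
    hcusp hne hfe h2

/-- **The Jacobian of `C₂₇₇` is paramodular of level `277` away from `277` — criterion discharged**
([BPPTVY, Thm. 1.2.1 / Thm. 7.1.3] for `p ≠ 277`): same statement as `Paramodular277.paramodular_277`
WITHOUT the hypothesis `hFS`, supplied by `traceEq_of_faltingsSerre_symplectic_holds`.  Remaining
inputs: the certificate `hC` (canonical sha256 recorded in the docstring of
`Paramodular277.Certificate277`), the `A`-side data `hframe`/`hA`, the cited `ρ_{f,2}` of Thm. 4.3.4
(`hρf`, Arthur-dependent), the form data `hcusp`/`hne`/`hfe`, and `h2`.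
[cite: BrumerEtAl2019, Thm 1.2.1 pp. 1146–1147; Thm 7.1.3 pp. 1187–1188; Thm 4.3.4 p. 1169] -/
theorem paramodular_277_holds
    {A : AbelianVariety ℚ} {f : Matrix (Fin 2) (Fin 2) ℂ → ℂ}
    {ρA ρf : FramedGaloisRep ℚ ℤ_[2] 4} {J : Matrix (Fin 4) (Fin 4) ℤ_[2]}
    {ν : Field.absoluteGaloisGroup ℚ → ℤ_[2]}
    {b : Module.Basis (Fin 4) ℚ_[2] (A.rationalTateModule 2)}
    (hC : Paramodular277.Certificate277 J ν ρA ρf)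
    (hframe : A.IsFrameOfTateRep 2 b (rationalize ρA))
    (aA bA af bf : ℕ → ℤ)
    (hA : ∀ p : ℕ, p.Prime → ¬ p ∣ 277 →
      A.HasGoodEulerFactorAt p ((lPolynomialOfSurface p (aA p) (bA p)).map (Int.castRingHom ℚ)))
    (hρf : ∀ p : ℕ, p.Prime → ¬ p ∣ 277 → p ≠ 2 →
      ∀ v : HeightOneSpectrum (𝓞 ℚ), ((p : ℕ) : 𝓞 ℚ) ∈ v.asIdeal →
        ρf.HasFrobCharpolyAt v
          ((lPolynomialOfSurface p (af p) (bf p)).reverse.map (Int.castRingHom ℤ_[2])))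
    (hcusp : IsParamodularCuspForm 277 2 f) (hne : ∃ Z ∈ siegelUpperHalfSpace 2, f Z ≠ 0)
    (hfe : ∀ p : ℕ, p.Prime → ¬ p ∣ 277 →
      HasSpinorEulerFactorAt 2 p f ((lPolynomialOfSurface p (af p) (bf p)).map (Int.castRingHom ℂ)))
    (h2 : aA 2 = af 2 ∧ bA 2 = bf 2) :
    IsParamodularAwayFrom A 277 f :=
  Paramodular277.paramodular_277 traceEq_of_faltingsSerre_symplectic_holds hC hframe aA bA af bf hA hρf
    hcusp hne hfe h2

end Literature.NumberTheory.FaltingsSerre
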